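import Summits.ResolutionOfSingularities.ResolutionOfSingularities.Theorems.FrobeniusClosingPatchingRelPerfectDepthLegalHSHypersurface
import Literature.AlgebraicGeometry.Resolution.EmbeddedResolutionExcellentSurfacesHistory
import Literature.AlgebraicGeometry.Resolution.EmbeddedResolutionExcellentSurfaces
import Literature.AlgebraicGeometry.Resolution.NormalCrossingsStrictification
import Literature.AlgebraicGeometry.Resolution.NoetherianComponents
import Literature.AlgebraicGeometry.Resolution.SubschemeRegularStalks
import Literature.AlgebraicGeometry.Resolution.BlowupsIntegral
import Literature.Topology.KrullDimensionDrop
import HarnessLib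

/-!
# Crux `PatchingRelPerfect` (stmt-ResolutionOfSingularities-16161), chain W5.2 — T6-E1b residual, the `SingCentres₃`
# discharge (RESTART loop): reading the CUT off one step of the CJS construction fact (F-72)

[OURS · L1 W5.2 · `SingCentres₃` discharge = RESTART AT THE FIRST REGULAR COMPONENT (res-L1-w52-plan-1 RULING R4 (3); res-type-049;
OWNER NOTE O3.1), brick R3 «the cut», against the tree's F-72 vocabulary
`Literature/AlgebraicGeometry/Resolution/EmbeddedResolutionExcellentSurfacesHistory.lean` (`CJSHistory.hsFunOn`, `hsOOn`,
`boundaryTransform`, `IsSigmaOMaxElimination`)] Fact-free (the named fact F-72 is NOT consumed here); NOT statements of the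
manuscript under review.

THE POINT. A step of a `Σ^{O,max}`-elimination (F-72's `IsSigmaOMaxElimination.blowup`) blows up a centre `D` every point `x` of
which carries a value `H^{O}(x)` that is MAXIMAL among the current values on the part of the strict transform `X'` lying over the
round-start connected component of `x` (Def. 6.23 (2)). By CJS Lemma 2.31 (`Φ^{(N)} < H_X(y)` at a singular point `y`, `= Φ^{(N)}`
at a regular point of dimension `≤ N`; res-D-pv-055's N5 brick) and the LEXICOGRAPHIC order of `H^O = (H_X, |O|)`: if `x` is a
REGULAR point of `X'` then EVERY point of that part is regular — in particular the connected component `F` of `X'` through `x`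
is a non-empty, closed, relatively open (Noetherian) piece of `X'` consisting of regular points: the FROZEN PIECE of the restart
loop. Otherwise `x` is singular, and the step is a step of the tree's Sing-centred predicate `IsBPermissibleSequence`, the boundary
families of F-72 (`boundaryTransform`, `ℕ`-labelled) having the union `τ⁻¹(⋃ B ∪ D)` that predicate tracks.

* `iUnion_boundaryTransform_eq` (+ closedness / emptiness of the labelled members) — F-72's boundary family vs the tree's set;
* `hsFunOn_subschemeι` — F-72's `hsFunOn` IS `Scheme.hsFun` of the reduced strict transform;
* `ringKrullDim_stalk_subscheme_le` — points of a proper closed subset of an integral threefold have quotient stalks of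
  dimension `≤ 2`;
* `hsOOn_lt_of_regular_of_not_regular` — **(K)**: regular `x`, singular `y` ⇒ `H^O(x) < H^O(y)`;
* `exists_frozen_piece` — **THE CUT**: from Def. 6.23 (2)'s maximality at a REGULAR centre point, the frozen piece.

AI-written; AI review is weaker than expert review.

## References
* V. Cossart, U. Jannsen, S. Saito, LNM 2270 (2020), Lemma 2.31, Def. 4.4 (b), Def. 6.23 (2)(3), Cor. 6.26. [CossartJannsenSaito2020]
* The Stacks Project, Tags 02OS, 0357. [StacksProject]
-/

-- `Summit.<Summit>.<Sub>.Theorems` with `Sub = Summit` (single-conjunct summit, D-0017)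
set_option linter.dupNamespace false

noncomputable section

open CategoryTheory CategoryTheory.Limits AlgebraicGeometry TopologicalSpace IsLocalRing
open Literature.AlgebraicGeometry.Resolution Scheme.IdealSheafData
open Literature.RingTheory.HilbertSamuel
open Literature.AlgebraicGeometry.Resolution.CJSHistory

namespace Summit.ResolutionOfSingularities.ResolutionOfSingularities.Theorems

universe u

namespace LegalRestart

variable {Z : Scheme.{u}}

/-! ## §1 F-72's labelled boundary family versus the boundary set -/

/-- **The union of the transformed boundary family is the complete transform of the boundary set**: for closed members,
none beyond the counter, and a closed centre `D`, `⋃_i B'_i = τ⁻¹(⋃_i B_i ∪ D)` (Def. 4.4 (b): strict transforms of the old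
members plus the exceptional divisor; a point of `τ⁻¹B_i` over `D` lies on the exceptional member).
[cite: CossartJannsenSaito2020, Def. 4.4 (b)] -/
theorem iUnion_boundaryTransform_eq {Z' : Scheme.{u}} (τ : Z' ⟶ Z) {B : ℕ → Set Z} {k : ℕ} {D : Set Z}
    (hcl : ∀ i, IsClosed (B i)) (hk : ∀ i, k ≤ i → B i = ∅) :
    (⋃ i, boundaryTransform τ B k D i) = τ ⁻¹' ((⋃ i, B i) ∪ D) := by
  ext z
  simp only [Set.mem_iUnion, Set.mem_preimage, Set.mem_union]
  constructor
  · rintro ⟨i, hi⟩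
    rcases lt_trichotomy i k with h | rfl | h
    · rw [boundaryTransform_of_lt τ B k D h] at hi
      have h1 : z ∈ τ ⁻¹' B i :=
        closure_minimal (Set.preimage_mono Set.sdiff_subset) ((hcl i).preimage τ.continuous) hi
      exact Or.inl ⟨i, h1⟩
    · rw [boundaryTransform_self] at hi
      exact Or.inr hi
    · rw [boundaryTransform_of_gt τ B k D h] at hi
      exact absurd hi (Set.notMem_empty z)
  · rintro (⟨i, hi⟩ | hz)
    · by_cases hzD : τ z ∈ D
      · exact ⟨k, by rw [boundaryTransform_self]; exact hzD⟩
      · have hik : i < k := by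
          by_contra h
          rw [hk i (not_lt.mp h)] at hi
          exact hi
        exact ⟨i, by rw [boundaryTransform_of_lt τ B k D hik]; exact subset_closure ⟨hi, hzD⟩⟩
    · exact ⟨k, by rw [boundaryTransform_self]; exact hz⟩

/-- The transformed members are closed (for a closed centre). [cite: CossartJannsenSaito2020, Def. 4.4 (b)] -/
theorem isClosed_boundaryTransform {Z' : Scheme.{u}} (τ : Z' ⟶ Z) (B : ℕ → Set Z) (k : ℕ) {D : Set Z} (hD : IsClosed D)
    (i : ℕ) : IsClosed (boundaryTransform τ B k D i) := by
  rcases lt_trichotomy i k with h | rfl | h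
  · rw [boundaryTransform_of_lt τ B k D h]; exact isClosed_closure
  · rw [boundaryTransform_self]; exact hD.preimage τ.continuous
  · rw [boundaryTransform_of_gt τ B k D h]; exact isClosed_empty

/-- No transformed member beyond the new counter `k + 1`. [cite: CossartJannsenSaito2020, Def. 4.4 (b)] -/
theorem boundaryTransform_eq_empty_of_le {Z' : Scheme.{u}} (τ : Z' ⟶ Z) (B : ℕ → Set Z) (k : ℕ) (D : Set Z) {i : ℕ}
    (hi : k + 1 ≤ i) : boundaryTransform τ B k D i = ∅ :=
  boundaryTransform_of_gt τ B k D (by omega)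

/-! ## §2 F-72's `hsFunOn` is the Hilbert–Samuel function of the reduced strict transform -/

/-- **`hsFunOn Z X N (ι t) = H^N_{S}(t)`** for the reduced closed subscheme `ι : S = V(𝓘(cl X)) ↪ Z` (the `dite` of the
definition, the closed immersion being injective). [cite: CossartJannsenSaito2020, Def. 2.28 (3)] -/
theorem hsFunOn_subschemeι (X : Set Z) (N : ℕ)
    (t : ↥((vanishingIdeal (⟨closure X, isClosed_closure⟩ : Closeds Z)).subscheme)) :
    hsFunOn Z X N ((vanishingIdeal (⟨closure X, isClosed_closure⟩ : Closeds Z)).subschemeι t) =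
      Scheme.hsFun ((vanishingIdeal (⟨closure X, isClosed_closure⟩ : Closeds Z)).subscheme) N t := by
  have hex : ∃ t' : ↥((vanishingIdeal (⟨closure X, isClosed_closure⟩ : Closeds Z)).subscheme),
      (vanishingIdeal (⟨closure X, isClosed_closure⟩ : Closeds Z)).subschemeι t' =
        (vanishingIdeal (⟨closure X, isClosed_closure⟩ : Closeds Z)).subschemeι t := ⟨t, rfl⟩
  unfold hsFunOn
  rw [dif_pos hex]
  congr 1
  exact (vanishingIdeal (⟨closure X, isClosed_closure⟩ : Closeds Z)).subschemeι.isClosedEmbedding.injective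
    hex.choose_spec

/-! ## §3 Dimension of the quotient stalks of a proper closed subset of an integral threefold -/

/-- **The local rings of the reduced structure on a closed `X ⊊ Z` of an integral threefold have dimension `≤ 2`**
(`dim X ≤ 2` for a proper closed subset of an irreducible space of dimension `3`; `dim 𝒪_{S,t} ≤ dim S`). [folklore] -/
theorem ringKrullDim_stalk_subscheme_le [IsIntegral Z] (hdim : topologicalKrullDim Z = 3) {X : Set Z} (hX : IsClosed X)
    (hXne : X ≠ Set.univ) (t : ↥((vanishingIdeal (⟨closure X, isClosed_closure⟩ : Closeds Z)).subscheme)) :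
    ringKrullDim (((vanishingIdeal (⟨closure X, isClosed_closure⟩ : Closeds Z)).subscheme).presheaf.stalk t) ≤ (2 : ℕ) := by
  have hcl : (⟨closure X, isClosed_closure⟩ : Closeds Z) = ⟨X, hX⟩ := Closeds.ext hX.closure_eq
  have hdimX : topologicalKrullDim X ≤ 2 := by
    have hlt := Literature.Topology.topologicalKrullDim_lt_of_isClosed_ssubset hX hXne (2 + 1)
      (by rw [hdim]; exact_mod_cast (by norm_num : (3 : ℕ) < 2 + 1 + 1))
    rw [Nat.cast_add_one] at hlt
    exact_mod_cast (ENat.WithBot.lt_add_one_iff.mp hlt)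
  have hdimS : topologicalKrullDim ↥((vanishingIdeal (⟨closure X, isClosed_closure⟩ : Closeds Z)).subscheme) ≤ (2 : ℕ) := by
    rw [topologicalKrullDim_subscheme_vanishingIdeal, hcl]
    exact_mod_cast hdimX
  exact (ringKrullDim_stalk_le_topologicalKrullDim _ t).trans hdimS

/-! ## §4 (K): a regular point's value lies strictly below a singular point's -/

/-- **(K) CJS Lemma 2.31 in the lexicographic `H^O`**: for `x, y` on the closed `X ⊊ Z` (`Z` an integral threefold), `x` a
REGULAR point of the reduced structure and `y` a SINGULAR one, `H^O(x) < H^O(y)` for every history `O` — `H_X(x) = Φ^{(N)}`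
(`dim 𝒪_{X,x} ≤ 2 ≤ N`) and `Φ^{(N)} < H_X(y)` (res-D-pv-055 `DepthLegal.iterPSum_Phi_lt_hsFun_of_not_isRegularLocalRing`), and the
first component decides. [cite: CossartJannsenSaito2020, Lemma 2.31, Ch. 4 (p. 55)] -/
theorem hsOOn_lt_of_regular_of_not_regular [IsIntegral Z] [IsNoetherian Z] (hdim : topologicalKrullDim Z = 3) {X : Set Z}
    (hX : IsClosed X) (hXne : X ≠ Set.univ) {N : ℕ} (hN : 2 ≤ N) (O : Z → Set ℕ) {x y : Z} (hx : x ∈ X) (hy : y ∈ X)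
    (hxreg : IsRegularLocalRing (Z.presheaf.stalk x ⧸ stalkIdeal (vanishingIdeal ⟨closure X, isClosed_closure⟩) x))
    (hysing : ¬ IsRegularLocalRing (Z.presheaf.stalk y ⧸ stalkIdeal (vanishingIdeal ⟨closure X, isClosed_closure⟩) y)) :
    hsOOn Z X N O x < hsOOn Z X N O y := by
  set I := vanishingIdeal (⟨closure X, isClosed_closure⟩ : Closeds Z) with hI
  have hsupp : (I.support : Set Z) = X := by
    rw [hI, Scheme.IdealSheafData.coe_support_vanishingIdeal, Closeds.coe_mk, hX.closure_eq]
  -- the points of the subscheme over `x` and `y`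
  have hxr : x ∈ Set.range I.subschemeι := by rw [range_subschemeι, hsupp]; exact hx
  have hyr : y ∈ Set.range I.subschemeι := by rw [range_subschemeι, hsupp]; exact hy
  obtain ⟨tx, htx⟩ := hxr
  obtain ⟨ty, hty⟩ := hyr
  haveI : IsLocallyNoetherian I.subscheme := LocallyOfFiniteType.isLocallyNoetherian I.subschemeι
  -- regularity of the stalks of the subscheme
  obtain ⟨ex⟩ := DepthLegal.nonempty_stalk_subscheme_ringEquiv I tx
  obtain ⟨ey⟩ := DepthLegal.nonempty_stalk_subscheme_ringEquiv I ty
  have htx' : I.subschemeι.base tx = x := htx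
  have hty' : I.subschemeι.base ty = y := hty
  have hregx : IsRegularLocalRing (I.subscheme.presheaf.stalk tx) := by
    rw [htx'] at ex; haveI := hxreg; exact IsRegularLocalRing.of_ringEquiv ex
  have hsingy : ¬ IsRegularLocalRing (I.subscheme.presheaf.stalk ty) := by
    intro h
    rw [hty'] at ey
    haveI := h
    exact hysing (IsRegularLocalRing.of_ringEquiv ey.symm)
  -- the values
  have hvx : hsFunOn Z X N x = iterPSum N Phi := by
    rw [← htx, hsFunOn_subschemeι]
    refine (Scheme.hsFun_eq_iterPSum_Phi_iff N tx).mpr ⟨hregx, ?_⟩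
    exact (ringKrullDim_stalk_subscheme_le hdim hX hXne tx).trans (by exact_mod_cast hN)
  have hvy : iterPSum N Phi < hsFunOn Z X N y := by
    rw [← hty, hsFunOn_subschemeι]
    exact DepthLegal.iterPSum_Phi_lt_hsFun_of_not_isRegularLocalRing N hsingy
  rw [hsOOn_eq, hsOOn_eq, Prod.Lex.toLex_lt_toLex, hvx]
  exact Or.inl hvy

/-! ## §5 THE CUT: the frozen piece at a regular centre point -/

/-- The connected component of `X'` through `x` maps into the connected component of `Xr` through `ρ x` (continuity).
[folklore] -/
theorem connectedComponentIn_subset_preimage {Zr : Scheme.{u}} (ρ : Z ⟶ Zr) {X' : Set Z} {Xr : Set Zr}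
    (hX : ρ '' X' ⊆ Xr) (x : Z) :
    connectedComponentIn X' x ⊆ ρ ⁻¹' connectedComponentIn Xr (ρ x) := by
  by_cases hx : x ∈ X'
  · intro y hy
    have h1 : _root_.IsPreconnected (ρ '' connectedComponentIn X' x) :=
      isPreconnected_connectedComponentIn.image _ ρ.continuous.continuousOn
    exact h1.subset_connectedComponentIn (Set.mem_image_of_mem _ (mem_connectedComponentIn hx))
      ((Set.image_mono (connectedComponentIn_subset X' x)).trans hX) (Set.mem_image_of_mem _ hy)
  · rw [connectedComponentIn_eq_empty hx]; exact Set.empty_subset _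

/-- **Connected components of a closed subset of a Noetherian scheme are closed and relatively open** (Noetherian spaces
have clopen connected components, tree `isClopen_connectedComponent_of_noetherianSpace`). [folklore] -/
theorem connectedComponentIn_closed_relOpen [IsNoetherian Z] {X' : Set Z} (hX' : IsClosed X') {x : Z} (hx : x ∈ X') :
    IsClosed (connectedComponentIn X' x) ∧ ∃ O : Set Z, IsOpen O ∧ X' ∩ O = connectedComponentIn X' x := by
  have hcl := isClopen_connectedComponent_of_noetherianSpace (⟨x, hx⟩ : X')
  rw [connectedComponentIn_eq_image hx]
  refine ⟨hX'.isClosedEmbedding_subtypeVal.isClosedMap _ hcl.1, ?_⟩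
  obtain ⟨O, hO, hOeq⟩ := isOpen_induced_iff.mp hcl.2
  refine ⟨O, hO, ?_⟩
  rw [← hOeq, Subtype.image_preimage_coe, Set.inter_comm]

/-- **THE CUT.** At a step of F-72's elimination, let `x ∈ X'` (closed, `⊊ Z`, `Z` an integral Noetherian threefold) be a
REGULAR point of the reduced structure whose value `H^{O'}(x)` is maximal among the values on `X' ∩ ρ⁻¹U`, `U` the round-start
connected component of `ρ x` (Def. 6.23 (2), F-72's `hmax`). Then the connected component `F` of `X'` through `x` is a
non-empty closed, relatively open piece of `X'` all of whose points are REGULAR points of the reduced structure (by (K), a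
singular point over `U` would dominate `x`). [cite: CossartJannsenSaito2020, Def. 6.23 (2), Lemma 2.31] -/
theorem exists_frozen_piece [IsIntegral Z] [IsNoetherian Z] (hdim : topologicalKrullDim Z = 3) {X' : Set Z}
    (hX' : IsClosed X') (hXne : X' ≠ Set.univ) {N : ℕ} (hN : 2 ≤ N) (O' : Z → Set ℕ)
    {Zr : Scheme.{u}} (ρ : Z ⟶ Zr) {Xr : Set Zr} (hXr : ρ '' X' ⊆ Xr) {x : Z} (hx : x ∈ X')
    (hxreg : IsRegularLocalRing (Z.presheaf.stalk x ⧸ stalkIdeal (vanishingIdeal ⟨closure X', isClosed_closure⟩) x))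
    (hmax : Maximal (· ∈ hsOOn Z X' N O' '' (X' ∩ ρ ⁻¹' connectedComponentIn Xr (ρ x))) (hsOOn Z X' N O' x)) :
    ∃ F : Set Z, F ⊆ X' ∧ x ∈ F ∧ IsClosed F ∧ (∃ O : Set Z, IsOpen O ∧ X' ∩ O = F) ∧
      ∀ y ∈ F, IsRegularLocalRing (Z.presheaf.stalk y ⧸ stalkIdeal (vanishingIdeal ⟨closure X', isClosed_closure⟩) y) := by
  obtain ⟨hFc, hFo⟩ := connectedComponentIn_closed_relOpen hX' hx
  refine ⟨connectedComponentIn X' x, connectedComponentIn_subset X' x, mem_connectedComponentIn hx, hFc, hFo,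
    fun y hy => ?_⟩
  by_contra hysing
  have hyX : y ∈ X' := connectedComponentIn_subset X' x hy
  have hyU : y ∈ X' ∩ ρ ⁻¹' connectedComponentIn Xr (ρ x) := ⟨hyX, connectedComponentIn_subset_preimage ρ hXr x hy⟩
  have hlt := hsOOn_lt_of_regular_of_not_regular hdim hX' hXne hN O' hx hyX hxreg hysing
  have hle := hmax.2 (Set.mem_image_of_mem _ hyU) hlt.le
  exact lt_irrefl _ (lt_of_lt_of_le hlt hle)

end LegalRestart

end Summit.ResolutionOfSingularities.ResolutionOfSingularities.Theorems

end
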